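import Mathlib
import Summits.CriticalPhenomena.CardyFormulaZ2.Theorems.CardyMagicRigidityNestingRigidityFirstMomentIdentity
import Summits.CriticalPhenomena.CardyFormulaZ2.Theorems.CardyMagicRigidityNestingRigidityTowerIndependence
import HarnessLib

/-!
# Crux `NestingRigidity`, line `ring-cloud-tomography` (r5): the EXACT independence split of the
# additive UV statistic behind hypothesis (L) of `uvDecoupling_of_tilted_moments`, both lattices

Crux `Summit.CriticalPhenomena.CardyFormulaZ2.Theses.CardyMagicRigidity.NestingRigidity`
(stmt-CriticalPhenomena-4835), line `ring-cloud-tomography`, stub R1'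
`stub_uvDecoupling : ∀ E ∈ latticeEnsembles, UVDecoupling E`.  Hypothesis (L) of the reduction
`uvDecoupling_of_tilted_moments` (…UVLinearisation) asks for the one-sided TILTED first moment
`E_δ[w^N Θ] ≤ (C − t·E_δ N)·E_δ[w^N]` of the additive UV statistic `Θ = Σ_{u ∉ tower} θ_u`
(`w = magicWeight t`, `N = N_0(r,1)`, `θ_u` the phase of `u` against the cone density); its
untilted mean is known EXACTLY on `𝕋` (`integral_finsum_nestingPhase_sdiff_tower_tEns`).  What is
missing is the TILT TRANSFER `Cov(w^N, Θ) ≤ C·E[w^N]`; this file proves its EXACT part (no cited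
fact, no definition):
* §1 cylinder property of the loop families AVOIDING A SET `A`: on bond-`ℤ²` they read only the
  edges with medial point off `A` (`mem_range_loopCurve`, `isInterfaceLoop_congr`), on site-`𝕋` only
  the sites within `δ` of a point off `A` (`isSiteInterfaceLoop_congr_of_darts`);
* §2 with the FAR FAMILY `F = {u ∈ loops | trace ∩ A* = ∅}`, `A* = B̄(0, 1 + 2δ) ∖ B(0, r − 2δ)`,
  every statistic `Σ_{F} g` is INDEPENDENT of `N_0(r,1)` under `E.P`, `E ∈ latticeEnsembles` (the
  tower reads the `δ`-thickened annulus only, `TowerIndependence.towerCount_zEns_inter` /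
  `towerCount_tEns_inter`), whence the product formula `E_δ[w^N Σ_F g] = E_δ[w^N]·E_δ[Σ_F g]`;
* §3 the pathwise split `loops ∖ tower = F ⊔ B` (far loops are never tower loops), `B` the
  BOUNDARY FAMILY of non-tower loops meeting `A*`, for every `g` with finitely many contributors;
* §4 (registered anchor `integral_towerWeight_mul_uvPhase_eq_split`) on both lattices, every mesh
  `δ > 0`, EVERY real `w`: `E_δ[w^N Θ] = E_δ[w^N]·(E_δ[Θ] − E_δ[Θ_B]) + E_δ[w^N Θ_B]` — the tilt
  transfer is exactly the control of the boundary statistic `Θ_B` (loops crossing the collars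
  `{r − 2δ ≤ |z| ≤ r}`, `{1 ≤ |z| ≤ 1 + 2δ}`, and exit loops), untilted and tilted.
-/

noncomputable section

open MeasureTheory ProbabilityTheory Set Filter Metric
open scoped Real Topology BigOperators

namespace Summit.CriticalPhenomena.CardyFormulaZ2.Cruxes.NestingRigidity.RingCloudTomography

open Literature.Probability.RandomPlanarGeometry Literature.Probability.Percolation
  Literature.Probability.LatticeModels
open Summit.CriticalPhenomena.CardyFormulaZ2.Cruxes.NestingRigidity.MarkovCascadeOneGeneration
  (isInterfaceLoop_congr isSiteInterfaceLoop_congr_of_darts)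
open Summit.CriticalPhenomena.CardyFormulaZ2.Cruxes.NestingRigidity.PositiveConeWeightDoubling
  (magicWeight meanTower coneCloud)

namespace TiltTransfer

/-! ## §1 Cylinder property of the loop families avoiding a set -/

/-- **Bond-`ℤ²`** (one inclusion): if two configurations agree on a set of edges `M` containing
every edge whose medial point lies off `A`, every loop of the first configuration whose trace
misses `A` is such a loop of the second. -/
theorem farFamily_zEns_subset_of_agree {δ : ℝ} {ω ω' M : BondConfig (Site 2)} {A : Set ℂ}
    (hM : ∀ e : MedialVertex, medialPoint δ e ∉ A → e ∈ M) (hagree : ∀ e ∈ M, e ∈ ω ↔ e ∈ ω') :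
    {u ∈ (zEns.X δ ω).loops | Disjoint u.range A} ⊆
      {u ∈ (zEns.X δ ω').loops | Disjoint u.range A} := by
  rintro u ⟨hu, hA⟩
  rw [loops_zEns_eq_image] at hu ⊢
  obtain ⟨k, hk, rfl⟩ := hu
  refine ⟨⟨k, ?_, rfl⟩, hA⟩
  refine (isInterfaceLoop_congr fun e he ↦ hagree e (hM e fun heA ↦ ?_)).1 hk
  have hmem : medialPoint δ e ∈
      (UnbasedLoop.mk (BasedLoop.mk (loopCurve δ 0 k.1) (isLoop_loopCurve δ 0 k.2))).range := by
    rw [UnbasedLoop.range_mk, BasedLoop.toCurveClass_mk]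
    simpa [Circle.exp_zero] using mem_range_loopCurve δ 0 he
  exact Set.disjoint_left.1 hA hmem heA

/-- **Bond-`ℤ²`**: closing every edge off `M` (`ω ↦ ω ∩ M`), `M` containing all edges with medial
point off `A`, does not change the family of loops of `X_δ(ω)` whose trace misses `A`. -/
theorem farFamily_zEns_inter (δ : ℝ) (ω M : BondConfig (Site 2)) (A : Set ℂ)
    (hM : ∀ e : MedialVertex, medialPoint δ e ∉ A → e ∈ M) :
    {u ∈ (zEns.X δ (ω ∩ M : BondConfig (Site 2))).loops | Disjoint u.range A} =
      {u ∈ (zEns.X δ ω).loops | Disjoint u.range A} :=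
  Set.Subset.antisymm
    (farFamily_zEns_subset_of_agree hM fun _ he ↦ ⟨fun h ↦ h.1, fun h ↦ ⟨h, he⟩⟩)
    (farFamily_zEns_subset_of_agree hM fun _ he ↦ ⟨fun h ↦ ⟨h, he⟩, fun h ↦ h.1⟩)

/-- **Site-`𝕋`** (one inclusion): if two configurations agree on a set of sites `S` containing
every site drawn (mesh `δ ≥ 0`) within `δ` of a point off `A`, every loop of the first
configuration whose trace misses `A` is such a loop of the second: the centre of the tail face of
each dart of the walk is on the trace and both endpoints of the crossed `𝕋`-dart are within `δ`
of it. -/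
theorem farFamily_tEns_subset_of_agree {δ : ℝ} (hδ : 0 ≤ δ) {ω ω' S : SiteConfig (Site 2)}
    {A : Set ℂ} (hS : ∀ (s : Site 2) (p : ℂ), p ∉ A → dist p (triMeshPoint δ s) ≤ δ → s ∈ S)
    (hagree : ∀ s ∈ S, s ∈ ω ↔ s ∈ ω') :
    {u ∈ (tEns.X δ ω).loops | Disjoint u.range A} ⊆
      {u ∈ (tEns.X δ ω').loops | Disjoint u.range A} := by
  rintro u ⟨hu, hA⟩
  rw [loops_tEns_eq_image] at hu ⊢
  obtain ⟨k, hk, rfl⟩ := hu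
  refine ⟨⟨k, ?_, rfl⟩, hA⟩
  refine (isSiteInterfaceLoop_congr_of_darts fun d hd e he ↦ ?_).1 hk
  have hp : (δ : ℂ) * hexCenter d.fst ∈
      (UnbasedLoop.mk (BasedLoop.mk (siteLoopCurve δ k.2) (isLoop_siteLoopCurve δ k.2))).range := by
    rw [UnbasedLoop.range_mk, BasedLoop.toCurveClass_mk]
    change (δ : ℂ) * hexCenter d.fst ∈ Set.range (k.2.toCurve fun w ↦ (δ : ℂ) * hexCenter w)
    exact SimpleGraph.Walk.mem_range_toCurve _ k.2 (k.2.dart_fst_mem_support_of_mem_darts hd)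
  have hpA : (δ : ℂ) * hexCenter d.fst ∉ A := fun h ↦ Set.disjoint_left.1 hA hp h
  have h2 : (triEdgeFaces e).2 = d.fst := by rw [he]
  have hfst : dist ((δ : ℂ) * hexCenter d.fst) (triMeshPoint δ e.fst) ≤ δ := by
    have := (hexCenter_triEdgeFaces_mem_closedBall hδ e).2
    rwa [h2, mem_closedBall] at this
  have hsnd : dist ((δ : ℂ) * hexCenter d.fst) (triMeshPoint δ e.snd) ≤ δ := by
    have := (hexCenter_triEdgeFaces_mem_closedBall hδ e.symm).1
    rwa [triEdgeFaces_symm_holds e, Prod.fst_swap, h2, mem_closedBall] at this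
  exact ⟨hagree _ (hS _ _ hpA hfst), hagree _ (hS _ _ hpA hsnd)⟩

/-- **Site-`𝕋`**: closing every site off `S` (`ω ↦ ω ∩ S`), `S` containing all sites within `δ`
of a point off `A`, does not change the family of loops of `X_δ(ω)` whose trace misses `A`. -/
theorem farFamily_tEns_inter {δ : ℝ} (hδ : 0 ≤ δ) (ω S : SiteConfig (Site 2)) (A : Set ℂ)
    (hS : ∀ (s : Site 2) (p : ℂ), p ∉ A → dist p (triMeshPoint δ s) ≤ δ → s ∈ S) :
    {u ∈ (tEns.X δ (ω ∩ S : SiteConfig (Site 2))).loops | Disjoint u.range A} =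
      {u ∈ (tEns.X δ ω).loops | Disjoint u.range A} :=
  Set.Subset.antisymm
    (farFamily_tEns_subset_of_agree hδ hS fun _ hs ↦ ⟨fun h ↦ h.1, fun h ↦ ⟨h, hs⟩⟩)
    (farFamily_tEns_subset_of_agree hδ hS fun _ hs ↦ ⟨fun h ↦ ⟨h, hs⟩, fun h ↦ h.1⟩)

/-! ## §2 Independence of far-loop statistics from the tower count -/

/-- **Bond-`ℤ²`**: every statistic `Σ_{u ∈ loops, trace ∩ A = ∅} g u` of the loops avoiding a set
`A` containing the midpoint annulus `B(x, R) ∖ B̄(x, ρ)` is independent of the tower count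
`N_x(ρ, R)` under `zEns.P` (disjoint edge sets of the product measure). -/
theorem indepFun_towerCount_finsum_far_zEns (δ : ℝ) {x : ℂ} {ρ R : ℝ} {A : Set ℂ}
    (hA : ball x R \ closedBall x ρ ⊆ A) (g : UnbasedLoop ℂ → ℝ) :
    IndepFun (fun ω ↦ towerCount (zEns.X δ ω) x ρ R)
      (fun ω ↦ ∑ᶠ u ∈ {u ∈ (zEns.X δ ω).loops | Disjoint u.range A}, g u) zEns.P :=
  TowerIndependence.indepFun_of_determined_zEns
    (M := {e : MedialVertex | medialPoint δ e ∈ ball x R \ closedBall x ρ})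
    (M' := {e : MedialVertex | medialPoint δ e ∉ A})
    (Set.disjoint_left.2 fun _ he he' ↦ he' (hA he))
    (measurable_towerCount zEns zEns_mem δ x ρ R)
    (FirstMoment.measurable_finsum_loops_sep zEns zEns_mem δ _ g)
    (fun ω ↦ TowerIndependence.towerCount_zEns_inter δ ω _ x ρ R fun _ he ↦ he)
    (fun ω ↦ congrArg (fun s : Set (UnbasedLoop ℂ) ↦ ∑ᶠ u ∈ s, g u)
      (farFamily_zEns_inter δ ω _ A fun _ he ↦ he))

/-- **Site-`𝕋`**: every statistic of the loops avoiding a set `A` that contains the closed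
`δ`-neighbourhood of the thickened annulus `B(x, R + δ) ∖ B̄(x, ρ − δ)` is independent of the
tower count `N_x(ρ, R)` under `tEns.P` (mesh `δ ≥ 0`; disjoint site sets). -/
theorem indepFun_towerCount_finsum_far_tEns {δ : ℝ} (hδ : 0 ≤ δ) {x : ℂ} {ρ R : ℝ} {A : Set ℂ}
    (hA : ∀ p q : ℂ, q ∈ ball x (R + δ) \ closedBall x (ρ - δ) → dist p q ≤ δ → p ∈ A)
    (g : UnbasedLoop ℂ → ℝ) :
    IndepFun (fun ω ↦ towerCount (tEns.X δ ω) x ρ R)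
      (fun ω ↦ ∑ᶠ u ∈ {u ∈ (tEns.X δ ω).loops | Disjoint u.range A}, g u) tEns.P :=
  TowerIndependence.indepFun_of_determined_tEns
    (S := {s : Site 2 | triMeshPoint δ s ∈ ball x (R + δ) \ closedBall x (ρ - δ)})
    (S' := {s : Site 2 | ∃ p : ℂ, p ∉ A ∧ dist p (triMeshPoint δ s) ≤ δ})
    (Set.disjoint_left.2 fun _ hs ⟨p, hpA, hps⟩ ↦ hpA (hA p _ hs hps))
    (measurable_towerCount tEns tEns_mem δ x ρ R)
    (FirstMoment.measurable_finsum_loops_sep tEns tEns_mem δ _ g)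
    (fun ω ↦ TowerIndependence.towerCount_tEns_inter hδ ω _ x ρ R fun _ hs ↦ hs)
    (fun ω ↦ congrArg (fun s : Set (UnbasedLoop ℂ) ↦ ∑ᶠ u ∈ s, g u)
      (farFamily_tEns_inter hδ ω _ A fun _ p hp hps ↦ ⟨p, hp, hps⟩))

/-- **Independence of far-loop statistics from the tower count on BOTH lattice ensembles.**  For
`E ∈ latticeEnsembles`, mesh `δ ≥ 0`, radius `r` and ANY real function `g` on loops, the
statistic `Σ_{u ∈ F} g u` of the FAR FAMILY `F = {u ∈ loops | trace ∩ A* = ∅}`,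
`A* = B̄(0, 1 + 2δ) ∖ B(0, r − 2δ)`, is independent of `N_0(r, 1)` under `E.P`. -/
theorem indepFun_towerCount_finsum_far : ∀ E ∈ latticeEnsembles, ∀ {δ : ℝ}, 0 ≤ δ →
    ∀ (r : ℝ) (g : UnbasedLoop ℂ → ℝ),
    IndepFun (fun ω ↦ towerCount (E.X δ ω) 0 r 1)
      (fun ω ↦ ∑ᶠ u ∈ {u ∈ (E.X δ ω).loops |
        Disjoint u.range (closedBall (0 : ℂ) (1 + 2 * δ) \ ball 0 (r - 2 * δ))}, g u) E.P := by
  intro E hE δ hδ r g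
  simp only [latticeEnsembles, Set.mem_insert_iff, Set.mem_singleton_iff] at hE
  rcases hE with rfl | rfl
  · refine indepFun_towerCount_finsum_far_zEns δ
      (A := closedBall (0 : ℂ) (1 + 2 * δ) \ ball 0 (r - 2 * δ)) (fun z hz ↦ ⟨?_, ?_⟩) g
    · exact closedBall_subset_closedBall (by linarith) (ball_subset_closedBall hz.1)
    · exact fun h ↦ hz.2 (ball_subset_closedBall (ball_subset_ball (by linarith) h))
  · refine indepFun_towerCount_finsum_far_tEns hδ
      (A := closedBall (0 : ℂ) (1 + 2 * δ) \ ball 0 (r - 2 * δ)) (fun p q hq hpq ↦ ⟨?_, ?_⟩) g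
    · have h1 : dist q 0 < 1 + δ := mem_ball.1 hq.1
      exact mem_closedBall.2 (by linarith [dist_triangle p q 0])
    · intro hp
      have h1 : dist p 0 < r - 2 * δ := mem_ball.1 hp
      have h2 : r - δ < dist q 0 := not_le.1 fun h ↦ hq.2 (mem_closedBall.2 h)
      linarith [dist_triangle q p 0, dist_comm p q]

/-- **Product formula** (both lattice ensembles, every mesh `δ ≥ 0`, EVERY real weight `w` and
every real `g`): `E_δ[w^{N_0(r,1)} · Σ_{u ∈ F} g u] = E_δ[w^{N_0(r,1)}] · E_δ[Σ_{u ∈ F} g u]` for the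
far family `F` (independence of a measurable image of the count; no integrability needed). -/
theorem integral_towerWeight_mul_finsum_far : ∀ E ∈ latticeEnsembles, ∀ {δ : ℝ}, 0 ≤ δ →
    ∀ (w r : ℝ) (g : UnbasedLoop ℂ → ℝ),
    ∫ ω, w ^ towerCount (E.X δ ω) 0 r 1 *
        ∑ᶠ u ∈ {u ∈ (E.X δ ω).loops |
          Disjoint u.range (closedBall (0 : ℂ) (1 + 2 * δ) \ ball 0 (r - 2 * δ))}, g u ∂E.P =
      E.towerMoment w δ r *
        ∫ ω, ∑ᶠ u ∈ {u ∈ (E.X δ ω).loops |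
          Disjoint u.range (closedBall (0 : ℂ) (1 + 2 * δ) \ ball 0 (r - 2 * δ))}, g u ∂E.P :=
  fun E hE δ hδ w r g ↦
    ((indepFun_towerCount_finsum_far E hE hδ r g).comp (measurable_of_countable fun n : ℕ ↦ w ^ n)
      measurable_id).integral_fun_mul_eq_mul_integral
      ((measurable_towerCount E hE δ 0 r 1).const_pow w).aestronglyMeasurable
      (FirstMoment.measurable_finsum_loops_sep E hE δ _ g).aestronglyMeasurable

/-! ## §3 The pathwise split `loops ∖ tower = far ⊔ boundary` -/

/-- **Far loops are never tower loops** (`δ, r ≥ 0`): a loop missing `B̄(0, 1 + 2δ) ∖ B(0, r − 2δ)`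
with trace in the unit window lies in `B(0, r − 2δ)`, so does not wind around `r ∈ B̄(0, r)`. -/
theorem not_tower_of_far {u : UnbasedLoop ℂ} {r δ : ℝ} (hδ : 0 ≤ δ) (hr : 0 ≤ r)
    (hu : Disjoint u.range (closedBall (0 : ℂ) (1 + 2 * δ) \ ball 0 (r - 2 * δ))) :
    ¬ (closedBall (0 : ℂ) r ⊆ {z | u.wind z ≠ 0} ∧ u.range ⊆ ball (0 : ℂ) 1) := by
  rintro ⟨hwind, hrange⟩
  have hin : u.range ⊆ ball (0 : ℂ) (r - 2 * δ) := fun z hz ↦ by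
    by_contra h
    exact Set.disjoint_left.1 hu hz
      ⟨closedBall_subset_closedBall (by linarith) (ball_subset_closedBall (hrange hz)), h⟩
  have hdist : dist ((r : ℝ) : ℂ) 0 = r := by
    rw [dist_zero_right, Complex.norm_real, Real.norm_eq_abs, abs_of_nonneg hr]
  have h0 : u.wind (r : ℂ) = 0 := u.wind_eq_zero_of_subset_ball hin (by rw [hdist]; linarith)
  exact hwind (mem_closedBall.2 hdist.le) h0

/-- **The split, for a general statistic.**  On any configuration, for every real `g` with
finitely many contributing loops, `δ ≥ 0`, `r ≥ 0`:
`Σ_{loops ∖ tower} g = Σ_{far} g + Σ_{boundary} g`, the BOUNDARY FAMILY being the non-tower loops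
whose trace meets `A* = B̄(0, 1 + 2δ) ∖ B(0, r − 2δ)`. -/
theorem finsum_sdiff_tower_eq_far_add_bd (c : LoopConfig ℂ) {g : UnbasedLoop ℂ → ℝ}
    (hfin : (c.loops ∩ Function.support g).Finite) {r δ : ℝ} (hδ : 0 ≤ δ) (hr : 0 ≤ r) :
    ∑ᶠ u ∈ c.loops \ {u ∈ c.loops |
        closedBall (0 : ℂ) r ⊆ {z | u.wind z ≠ 0} ∧ u.range ⊆ ball (0 : ℂ) 1}, g u =
      (∑ᶠ u ∈ {u ∈ c.loops |
          Disjoint u.range (closedBall (0 : ℂ) (1 + 2 * δ) \ ball 0 (r - 2 * δ))}, g u) +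
        ∑ᶠ u ∈ {u ∈ c.loops |
          ¬ Disjoint u.range (closedBall (0 : ℂ) (1 + 2 * δ) \ ball 0 (r - 2 * δ)) ∧
            ¬ (closedBall (0 : ℂ) r ⊆ {z | u.wind z ≠ 0} ∧ u.range ⊆ ball (0 : ℂ) 1)}, g u := by
  set A := closedBall (0 : ℂ) (1 + 2 * δ) \ ball 0 (r - 2 * δ)
  set P : UnbasedLoop ℂ → Prop := fun u ↦
    closedBall (0 : ℂ) r ⊆ {z | u.wind z ≠ 0} ∧ u.range ⊆ ball (0 : ℂ) 1
  have hsplit : c.loops \ {u ∈ c.loops | P u} =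
      {u ∈ c.loops | Disjoint u.range A} ∪ {u ∈ c.loops | ¬ Disjoint u.range A ∧ ¬ P u} := by
    ext u
    simp only [Set.mem_sdiff, Set.mem_setOf_eq, Set.mem_union]
    constructor
    · rintro ⟨hu, hnot⟩
      by_cases hd : Disjoint u.range A
      · exact Or.inl ⟨hu, hd⟩
      · exact Or.inr ⟨hu, hd, fun hPu ↦ hnot ⟨hu, hPu⟩⟩
    · rintro (⟨hu, hd⟩ | ⟨hu, -, hPu⟩)
      · exact ⟨hu, fun h ↦ not_tower_of_far hδ hr hd h.2⟩
      · exact ⟨hu, fun h ↦ hPu h.2⟩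
  have hdisj : Disjoint {u ∈ c.loops | Disjoint u.range A}
      {u ∈ c.loops | ¬ Disjoint u.range A ∧ ¬ P u} :=
    Set.disjoint_left.2 fun u hu hu' ↦ hu'.2.1 hu.2
  change ∑ᶠ u ∈ c.loops \ {u ∈ c.loops | P u}, g u =
    (∑ᶠ u ∈ {u ∈ c.loops | Disjoint u.range A}, g u) +
      ∑ᶠ u ∈ {u ∈ c.loops | ¬ Disjoint u.range A ∧ ¬ P u}, g u
  rw [hsplit, finsum_mem_union' hdisj
    (hfin.subset (Set.inter_subset_inter_left _ (Set.sep_subset _ _)))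
    (hfin.subset (Set.inter_subset_inter_left _ (Set.sep_subset _ _)))]

/-- **The split on both lattice ensembles** (mesh `δ > 0`, every sample, charge `t`,
`0 < r ≤ 1`), for every `g` vanishing where the cone phase vanishes (e.g. `θ`, `θ²`; honest finite
sums: only loops meeting `B̄(0, 2)` contribute). -/
theorem finsum_sdiff_tower_eq_far_add_bd_latticeEnsembles : ∀ E ∈ latticeEnsembles, ∀ {δ : ℝ},
    0 < δ → ∀ (ω : E.Ω) (t : ℝ) {r : ℝ}, 0 < r → r ≤ 1 → ∀ g : UnbasedLoop ℂ → ℝ,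
    (∀ u : UnbasedLoop ℂ, u.nestingPhase (coneCloud t r).density = 0 → g u = 0) →
    ∑ᶠ u ∈ (E.X δ ω).loops \ {u ∈ (E.X δ ω).loops |
        closedBall (0 : ℂ) r ⊆ {z | u.wind z ≠ 0} ∧ u.range ⊆ ball (0 : ℂ) 1}, g u =
      (∑ᶠ u ∈ {u ∈ (E.X δ ω).loops |
          Disjoint u.range (closedBall (0 : ℂ) (1 + 2 * δ) \ ball 0 (r - 2 * δ))}, g u) +
        ∑ᶠ u ∈ {u ∈ (E.X δ ω).loops |
          ¬ Disjoint u.range (closedBall (0 : ℂ) (1 + 2 * δ) \ ball 0 (r - 2 * δ)) ∧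
            ¬ (closedBall (0 : ℂ) r ⊆ {z | u.wind z ≠ 0} ∧ u.range ⊆ ball (0 : ℂ) 1)}, g u :=
  fun E hE _ hδ ω _ _ hr hr1 _ hg ↦
    finsum_sdiff_tower_eq_far_add_bd _
      ((ConeTilt.finite_loops_meeting E hE hδ ω 2).subset fun u hu ↦
        ⟨hu.1, by_contra fun h ↦ hu.2 (hg u (UVLinear.cone_nestingPhase_eq_zero hr hr1 h))⟩)
      hδ.le hr.le

/-! ## §4 The tilted first moment through the split -/

/-- **Uniform bound on sub-family statistics**: if `|g| ≤ C` and `g` vanishes where the cone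
phase does, then `|Σ_{u ∈ loops, Q u} g u| ≤ B(δ)` for all samples and ALL predicates `Q`. -/
theorem exists_abs_finsum_sep_le : ∀ E ∈ latticeEnsembles, ∀ {δ : ℝ}, 0 < δ → ∀ (t : ℝ) {r : ℝ},
    0 < r → r ≤ 1 → ∀ (g : UnbasedLoop ℂ → ℝ) {C : ℝ}, 0 ≤ C → (∀ u, |g u| ≤ C) →
    (∀ u : UnbasedLoop ℂ, u.nestingPhase (coneCloud t r).density = 0 → g u = 0) →
    ∃ B : ℝ, ∀ (ω : E.Ω) (Q : UnbasedLoop ℂ → Prop),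
      |∑ᶠ u ∈ {u ∈ (E.X δ ω).loops | Q u}, g u| ≤ B := by
  intro E hE δ hδ t r hr hr1 g C hC0 hC hg
  obtain ⟨B, hB⟩ := FirstMoment.exists_abs_finsum_sdiff_le E hE hδ t hr hr1 g hC0 hC hg
  refine ⟨B, fun ω Q ↦ ?_⟩
  have h := hB ω {u ∈ (E.X δ ω).loops | ¬ Q u}
  rwa [FirstMoment.sdiff_sep_eq, show {u ∈ (E.X δ ω).loops | ¬¬Q u} =
    {u ∈ (E.X δ ω).loops | Q u} by simp only [not_not]] at h

/-- **Integrability of `w^{N_0(r,1)} · Σ_{u ∈ loops, Q u} g u`** on both lattices, for EVERY real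
`w`, mesh `δ > 0`, predicate `Q` and bounded `g` supported where the cone phase is non-zero. -/
theorem integrable_towerWeight_mul_finsum_sep : ∀ E ∈ latticeEnsembles, ∀ {δ : ℝ}, 0 < δ →
    ∀ (w t : ℝ) {r : ℝ}, 0 < r → r ≤ 1 → ∀ (Q : UnbasedLoop ℂ → Prop) (g : UnbasedLoop ℂ → ℝ)
    {C : ℝ}, 0 ≤ C → (∀ u, |g u| ≤ C) →
    (∀ u : UnbasedLoop ℂ, u.nestingPhase (coneCloud t r).density = 0 → g u = 0) →
    Integrable (fun ω ↦ w ^ towerCount (E.X δ ω) 0 r 1 *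
      ∑ᶠ u ∈ {u ∈ (E.X δ ω).loops | Q u}, g u) E.P := by
  intro E hE δ hδ w t r hr hr1 Q g C hC0 hC hg
  haveI := isProbabilityMeasure_of_mem hE
  obtain ⟨B, hB⟩ := exists_abs_finsum_sep_le E hE hδ t hr hr1 g hC0 hC hg
  obtain ⟨N, hN⟩ := ConeTilt.exists_towerCount_le E hE hδ 0 r 1
  have hm : Measurable fun ω ↦ w ^ towerCount (E.X δ ω) 0 r 1 *
      ∑ᶠ u ∈ {u ∈ (E.X δ ω).loops | Q u}, g u :=
    ((measurable_towerCount E hE δ 0 r 1).const_pow w).mul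
      (FirstMoment.measurable_finsum_loops_sep E hE δ Q g)
  refine Integrable.of_bound hm.aestronglyMeasurable (max 1 |w| ^ N * B)
    (Eventually.of_forall fun ω ↦ ?_)
  rw [Real.norm_eq_abs, abs_mul, abs_pow]
  have hB0 : 0 ≤ B := (abs_nonneg _).trans (hB ω fun _ ↦ True)
  exact mul_le_mul ((pow_le_pow_left₀ (abs_nonneg w) (le_max_right 1 |w|) _).trans
    (pow_le_pow_right₀ (le_max_left 1 |w|) (hN ω))) (hB ω Q) (abs_nonneg _) (by positivity)

/-- The untilted sub-family statistics are integrable (`w = 1`). -/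
theorem integrable_finsum_sep : ∀ E ∈ latticeEnsembles, ∀ {δ : ℝ}, 0 < δ →
    ∀ (t : ℝ) {r : ℝ}, 0 < r → r ≤ 1 → ∀ (Q : UnbasedLoop ℂ → Prop) (g : UnbasedLoop ℂ → ℝ)
    {C : ℝ}, 0 ≤ C → (∀ u, |g u| ≤ C) →
    (∀ u : UnbasedLoop ℂ, u.nestingPhase (coneCloud t r).density = 0 → g u = 0) →
    Integrable (fun ω ↦ ∑ᶠ u ∈ {u ∈ (E.X δ ω).loops | Q u}, g u) E.P := by
  intro E hE δ hδ t r hr hr1 Q g C hC0 hC hg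
  simpa only [one_pow, one_mul] using
    integrable_towerWeight_mul_finsum_sep E hE hδ 1 t hr hr1 Q g hC0 hC hg

end TiltTransfer

/-- **The tilted first moment of the UV statistic through the exact independence split**
(registered helper toward stub R1' `stub_uvDecoupling`, line `ring-cloud-tomography` r5).  For
`E ∈ latticeEnsembles`, mesh `δ > 0`, EVERY real weight `w`, charge `t` and `0 < r ≤ 1`, with
`Θ = Σ_{u ∉ tower} θ_u` the additive UV statistic of hypothesis (L) of
`uvDecoupling_of_tilted_moments` and `Θ_B = Σ_{u ∈ B} θ_u` its BOUNDARY PART (`B` = the non-tower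
loops whose trace meets `B̄(0, 1 + 2δ) ∖ B(0, r − 2δ)`):
`E_δ[w^N Θ] = E_δ[w^N] · (E_δ[Θ] − E_δ[Θ_B]) + E_δ[w^N Θ_B]` (`N = N_0(r,1)`; `Θ = Θ_F + Θ_B`
pathwise and the far part `Θ_F` is INDEPENDENT of `N`).  Hence the tilt transfer
`Cov(w^N, Θ) ≤ C·E[w^N]` of (L) is exactly the control of `Θ_B`, untilted and tilted. -/
theorem integral_towerWeight_mul_uvPhase_eq_split : ∀ E ∈ latticeEnsembles, ∀ {δ : ℝ}, 0 < δ →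
    ∀ (w t : ℝ) {r : ℝ}, 0 < r → r ≤ 1 →
    ∫ ω, w ^ towerCount (E.X δ ω) 0 r 1 *
        ∑ᶠ u ∈ (E.X δ ω).loops \ {u ∈ (E.X δ ω).loops |
          Metric.closedBall (0 : ℂ) r ⊆ {z | u.wind z ≠ 0} ∧ u.range ⊆ Metric.ball (0 : ℂ) 1},
          u.nestingPhase (coneCloud t r).density ∂E.P =
      E.towerMoment w δ r *
          ((∫ ω, ∑ᶠ u ∈ (E.X δ ω).loops \ {u ∈ (E.X δ ω).loops |
              Metric.closedBall (0 : ℂ) r ⊆ {z | u.wind z ≠ 0} ∧ u.range ⊆ Metric.ball (0 : ℂ) 1},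
              u.nestingPhase (coneCloud t r).density ∂E.P) -
            ∫ ω, ∑ᶠ u ∈ {u ∈ (E.X δ ω).loops |
              ¬ Disjoint u.range (Metric.closedBall (0 : ℂ) (1 + 2 * δ) \ Metric.ball 0 (r - 2 * δ)) ∧
                ¬ (Metric.closedBall (0 : ℂ) r ⊆ {z | u.wind z ≠ 0} ∧
                  u.range ⊆ Metric.ball (0 : ℂ) 1)},
              u.nestingPhase (coneCloud t r).density ∂E.P) +
        ∫ ω, w ^ towerCount (E.X δ ω) 0 r 1 *
          ∑ᶠ u ∈ {u ∈ (E.X δ ω).loops |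
            ¬ Disjoint u.range (Metric.closedBall (0 : ℂ) (1 + 2 * δ) \ Metric.ball 0 (r - 2 * δ)) ∧
              ¬ (Metric.closedBall (0 : ℂ) r ⊆ {z | u.wind z ≠ 0} ∧
                u.range ⊆ Metric.ball (0 : ℂ) 1)},
            u.nestingPhase (coneCloud t r).density ∂E.P := by
  intro E hE δ hδ w t r hr hr1
  set θ : UnbasedLoop ℂ → ℝ := fun u ↦ u.nestingPhase (coneCloud t r).density
  have habs : ∀ u, |θ u| ≤ |t| := fun u ↦
    ConeTilt.abs_cone_nestingPhase_le (𝔠 := coneCloud t r) rfl hr u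
  have hsupp : ∀ u : UnbasedLoop ℂ, u.nestingPhase (coneCloud t r).density = 0 → θ u = 0 :=
    fun _ h ↦ h
  -- the three families and the pathwise split
  set DF : UnbasedLoop ℂ → Prop := fun u ↦
    Disjoint u.range (closedBall (0 : ℂ) (1 + 2 * δ) \ ball 0 (r - 2 * δ))
  set DB : UnbasedLoop ℂ → Prop := fun u ↦
    ¬ Disjoint u.range (closedBall (0 : ℂ) (1 + 2 * δ) \ ball 0 (r - 2 * δ)) ∧
      ¬ (closedBall (0 : ℂ) r ⊆ {z | u.wind z ≠ 0} ∧ u.range ⊆ ball (0 : ℂ) 1)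
  have hsplit : ∀ ω, ∑ᶠ u ∈ (E.X δ ω).loops \ {u ∈ (E.X δ ω).loops |
      closedBall (0 : ℂ) r ⊆ {z | u.wind z ≠ 0} ∧ u.range ⊆ ball (0 : ℂ) 1}, θ u =
      (∑ᶠ u ∈ {u ∈ (E.X δ ω).loops | DF u}, θ u) + ∑ᶠ u ∈ {u ∈ (E.X δ ω).loops | DB u}, θ u :=
    fun ω ↦ TiltTransfer.finsum_sdiff_tower_eq_far_add_bd_latticeEnsembles E hE hδ ω t hr hr1 θ hsupp
  -- integrability of the pieces
  have hiF := TiltTransfer.integrable_finsum_sep E hE hδ t hr hr1 DF θ (abs_nonneg t) habs hsupp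
  have hiB := TiltTransfer.integrable_finsum_sep E hE hδ t hr hr1 DB θ (abs_nonneg t) habs hsupp
  have hiwF := TiltTransfer.integrable_towerWeight_mul_finsum_sep E hE hδ w t hr hr1 DF θ
    (abs_nonneg t) habs hsupp
  have hiwB := TiltTransfer.integrable_towerWeight_mul_finsum_sep E hE hδ w t hr hr1 DB θ
    (abs_nonneg t) habs hsupp
  -- the untilted split, integrated
  have hint : ∫ ω, ∑ᶠ u ∈ (E.X δ ω).loops \ {u ∈ (E.X δ ω).loops |
      closedBall (0 : ℂ) r ⊆ {z | u.wind z ≠ 0} ∧ u.range ⊆ ball (0 : ℂ) 1}, θ u ∂E.P =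
      (∫ ω, ∑ᶠ u ∈ {u ∈ (E.X δ ω).loops | DF u}, θ u ∂E.P) +
        ∫ ω, ∑ᶠ u ∈ {u ∈ (E.X δ ω).loops | DB u}, θ u ∂E.P := by
    rw [← integral_add hiF hiB]
    exact integral_congr_ae (Eventually.of_forall hsplit)
  -- the tilted split, integrated, and the product formula on the far part
  have hprod := TiltTransfer.integral_towerWeight_mul_finsum_far E hE hδ.le w r θ
  calc ∫ ω, w ^ towerCount (E.X δ ω) 0 r 1 *
        ∑ᶠ u ∈ (E.X δ ω).loops \ {u ∈ (E.X δ ω).loops |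
          closedBall (0 : ℂ) r ⊆ {z | u.wind z ≠ 0} ∧ u.range ⊆ ball (0 : ℂ) 1}, θ u ∂E.P
      = ∫ ω, (w ^ towerCount (E.X δ ω) 0 r 1 * ∑ᶠ u ∈ {u ∈ (E.X δ ω).loops | DF u}, θ u) +
          w ^ towerCount (E.X δ ω) 0 r 1 * ∑ᶠ u ∈ {u ∈ (E.X δ ω).loops | DB u}, θ u ∂E.P :=
        integral_congr_ae (Eventually.of_forall fun ω ↦ by dsimp only; rw [hsplit ω, mul_add])
    _ = E.towerMoment w δ r * (∫ ω, ∑ᶠ u ∈ {u ∈ (E.X δ ω).loops | DF u}, θ u ∂E.P) +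
          ∫ ω, w ^ towerCount (E.X δ ω) 0 r 1 * ∑ᶠ u ∈ {u ∈ (E.X δ ω).loops | DB u}, θ u ∂E.P := by
        rw [integral_add hiwF hiwB, hprod]
    _ = _ := by rw [hint]; ring

end Summit.CriticalPhenomena.CardyFormulaZ2.Cruxes.NestingRigidity.RingCloudTomography

end
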